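import Literature.Analysis.SegalBargmann.HeisenbergRealUniqueness
import Literature.Analysis.SegalBargmann.SchrodingerRepresentationL2
import Literature.Analysis.SegalBargmann.SchrodingerL2StrongContinuity
import HarnessLib

/-!
# The Stone–von Neumann theorem for the real Heisenberg group, unitary form: every irreducible unitary `𝐞`-representation is the Schrödinger representation on `L²(ℝ^σ)` (von Neumann 1931; Folland 1989 Thm (1.50))

Topic `Analysis/SegalBargmann`; namespace `Literature.Analysis.SegalBargmann`.

**Theorem** (`exists_linearIsometryEquiv_rhoRep`).  Let `π` be a unitary representation of the polarised real
Heisenberg group `HeisR σ` on a non-zero complex Hilbert space `E` whose orbit maps `(p,q) ↦ π((p,q),0) v` are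
continuous, whose centre acts by `ψ_∞ = 𝐞 = e^{2πi·}` and whose only closed invariant subspaces are `⊥` and `⊤`.
Then there is a unitary `U : E ≃ L²(ℝ^σ)` with `U ∘ π(h) = ρ(h) ∘ U` for all `h`, where `ρ = rhoRep σ` is the
Schrödinger representation (`SchrodingerRepresentationL2`); `U` is unique up to a scalar of modulus one
(`linearIsometryEquiv_rhoRep_unique`, Schur's lemma `rho_commutant_is_scalar`).  The model itself qualifies: it is
unitary, has central character `𝐞`, is irreducible (`rhoRep_irreducible`) and strongly continuous
(`continuous_rhoRep_apply`, from `SchrodingerL2StrongContinuity`).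

Proof: both `π` and `rhoRep σ` have unit vectors with the diagonal coefficient `vacuumCoeff σ`
(`exists_norm_eq_one_inner_apply_eq`, file `HeisenbergRealUniqueness`, from von Neumann's Gaussian vacuum
projection), and irreducible unitary representations with non-zero vectors of equal diagonal coefficient are
unitarily equivalent (`Unitary/CyclicCoefficientRigidity`).  Everything is PROVED; no cited statement is a hypothesis.

## References

* [vonNeumann1931] J. von Neumann, Die Eindeutigkeit der Schrödingerschen Operatoren, Math. Ann. 104 (1931)
  570–578, §4.
* [Folland1989] G. B. Folland, *Harmonic Analysis in Phase Space*, Princeton University Press, 1989, §1.3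
  (1.25), Prop. (1.43), §1.5 Theorem (1.50) (doi:10.1515/9781400882427).
-/

noncomputable section

open MeasureTheory Complex
open scoped InnerProductSpace ComplexConjugate FourierTransform

namespace Literature.Analysis.SegalBargmann

open Literature.RepresentationTheory.HeisenbergGroup Literature.RepresentationTheory.Unitary

set_option autoImplicit false

variable (σ : Type*) [Fintype σ]

/-! ## 1. The model `rhoRep σ` is strongly continuous; the uniqueness theorem -/

variable [DecidableEq σ]

/-- **Strong continuity of `rhoRep σ`**: `(p,q) ↦ ρ((p,q),0) f` is continuous for every `f ∈ L²(ℝ^σ)`.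
[cite: Folland1989, §1.3 (1.25)] -/
theorem continuous_rhoRep_apply (f : Lp ℂ 2 (volume : Measure (σ → ℝ))) :
    Continuous fun w : (σ → ℝ) × (σ → ℝ) => rhoRep σ ⟨w, 0⟩ f := by
  simp only [rhoRep_mk_zero_apply]
  have hc : Continuous fun w : (σ → ℝ) × (σ → ℝ) => ((𝐞 (-(2⁻¹ * (w.1 ⬝ᵥ w.2))) : Circle) : ℂ) :=
    (continuous_subtype_val.comp Real.continuous_fourierChar).comp
      ((continuous_fst.dotProduct continuous_snd).const_mul _).neg
  exact hc.smul (continuous_rho_apply f)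

/-- **The Stone–von Neumann theorem, unitary form, over `ℝ`**: every irreducible unitary representation of the
real Heisenberg group `HeisR σ` with continuous orbit maps and central character `𝐞` on a non-zero Hilbert space is
unitarily equivalent to the Schrödinger representation `rhoRep σ` on `L²(ℝ^σ)`.
[cite: vonNeumann1931, §4; Folland1989, §1.5 Theorem (1.50)] -/
theorem exists_linearIsometryEquiv_rhoRep {E : Type*} [NormedAddCommGroup E] [InnerProductSpace ℂ E]
    [CompleteSpace E] [Nontrivial E] (ρ : Representation ℂ (HeisR σ) E)
    (hρu : ∀ (h : HeisR σ) (v : E), ‖ρ h v‖ = ‖v‖)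
    (hρc : ∀ v : E, Continuous fun w : (σ → ℝ) × (σ → ℝ) => ρ ⟨w, 0⟩ v)
    (hρz : ∀ (t : ℝ) (v : E), ρ (Heisenberg.ofCenter (polar (dotPairing σ)) (Multiplicative.ofAdd t)) v =
      ((𝐞 t : Circle) : ℂ) • v)
    (hρi : ∀ K : Submodule ℂ E, IsClosed (K : Set E) → (∀ (h : HeisR σ), ∀ v ∈ K, ρ h v ∈ K) → K = ⊥ ∨ K = ⊤) :
    ∃ U : E ≃ₗᵢ[ℂ] Lp ℂ 2 (volume : Measure (σ → ℝ)),
      ∀ (h : HeisR σ) (v : E), U (ρ h v) = rhoRep σ h (U v) := by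
  haveI : Nontrivial (Lp ℂ 2 (volume : Measure (σ → ℝ))) := nontrivial_of_ne _ _ (vacL2_ne_zero (σ := σ))
  obtain ⟨v, hv1, hv⟩ := exists_norm_eq_one_inner_apply_eq ρ hρu hρc hρz
  obtain ⟨v₂, hv₂1, hv₂⟩ := exists_norm_eq_one_inner_apply_eq (rhoRep σ) (norm_rhoRep_apply σ)
    (continuous_rhoRep_apply σ) (rhoRep_center σ)
  have hv0 : v ≠ 0 := by rw [← norm_ne_zero_iff, hv1]; exact one_ne_zero
  have hv₂0 : v₂ ≠ 0 := by rw [← norm_ne_zero_iff, hv₂1]; exact one_ne_zero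
  have hcoef : ∀ h : HeisR σ, ⟪ρ h v, v⟫_ℂ = ⟪rhoRep σ h v₂, v₂⟫_ℂ := fun h => by
    obtain ⟨w, t⟩ := h
    rw [hv, hv₂]
  obtain ⟨U, -, hU⟩ := exists_linearIsometryEquiv_of_irreducible ρ (rhoRep σ) hρu (norm_rhoRep_apply σ) hρi
    (rhoRep_irreducible σ) hv0 hv₂0 hcoef
  exact ⟨U, hU⟩

/-- **Uniqueness of the intertwiner up to a scalar** (Schur's lemma for `ρ`, `rho_commutant_is_scalar`): two
unitary intertwiners `E → L²(ℝ^σ)` differ by a scalar of modulus one. [cite: Folland1989, Prop. (1.43), §1.5 Theorem (1.50)] -/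
theorem linearIsometryEquiv_rhoRep_unique {E : Type*} [NormedAddCommGroup E] [InnerProductSpace ℂ E]
    [CompleteSpace E] [Nontrivial E] (ρ : Representation ℂ (HeisR σ) E)
    (U₁ U₂ : E ≃ₗᵢ[ℂ] Lp ℂ 2 (volume : Measure (σ → ℝ)))
    (hU₁ : ∀ (h : HeisR σ) (v : E), U₁ (ρ h v) = rhoRep σ h (U₁ v))
    (hU₂ : ∀ (h : HeisR σ) (v : E), U₂ (ρ h v) = rhoRep σ h (U₂ v)) :
    ∃ c : ℂ, ‖c‖ = 1 ∧ ∀ v : E, U₂ v = c • U₁ v := by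
  set T : Lp ℂ 2 (volume : Measure (σ → ℝ)) →L[ℂ] Lp ℂ 2 (volume : Measure (σ → ℝ)) :=
    (U₁.symm.trans U₂).toLinearIsometry.toContinuousLinearMap
  have hTapp : ∀ f, T f = U₂ (U₁.symm f) := fun f => rfl
  have hsymm : ∀ (h : HeisR σ) (f : Lp ℂ 2 (volume : Measure (σ → ℝ))),
      U₁.symm (rhoRep σ h f) = ρ h (U₁.symm f) := fun h f => by
    apply U₁.injective
    rw [LinearIsometryEquiv.apply_symm_apply, hU₁, LinearIsometryEquiv.apply_symm_apply]
  have hTc : ∀ (p q : σ → ℝ) (f : Lp ℂ 2 (volume : Measure (σ → ℝ))), T (rho p q f) = rho p q (T f) :=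
    fun p q f => by
    rw [hTapp, hTapp, rho_eq_rhoRep σ, hsymm, hU₂, ← rho_eq_rhoRep σ]
  obtain ⟨c, hc⟩ := rho_commutant_is_scalar T hTc
  obtain ⟨x, hx⟩ := exists_ne (0 : E)
  refine ⟨c, ?_, fun v => ?_⟩
  · have h1 : ‖T (U₁ x)‖ = ‖U₁ x‖ := by
      rw [hTapp, LinearIsometryEquiv.norm_map, LinearIsometryEquiv.symm_apply_apply, LinearIsometryEquiv.norm_map]
    rw [hc, norm_smul] at h1
    have hx' : ‖U₁ x‖ ≠ 0 := by rw [LinearIsometryEquiv.norm_map]; exact norm_ne_zero_iff.mpr hx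
    exact mul_right_cancel₀ hx' (h1.trans (one_mul _).symm)
  · have := hc (U₁ v)
    rwa [hTapp, LinearIsometryEquiv.symm_apply_apply] at this

end Literature.Analysis.SegalBargmann

end
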